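import Summits.AtomisticToContinuum.HydrodynamicLimit.Theses.GermanoSplitLES
import Summits.AtomisticToContinuum.HydrodynamicLimit.Theorems.StiffCollisionalRelaxationAprioriBoundsEntropyRange
import Literature.MathematicalPhysics.KineticTheory.HardSphereEulerSolutionGluing
import Literature.MathematicalPhysics.KineticTheory.HardSphereEulerProofs
import Literature.Analysis.FunctionSpaces.TorusSpaceTime
import Literature.Analysis.FluidPDE.ReleaseLogBoundDatum
import Literature.Analysis.FluidPDE.HardSpherePhaseSpaceProofs
import HarnessLib

/-!
# Component (ii) of the crux `AprioriBounds` from `GermanoSplitLES.KineticRangeControl`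
(line `Sketch`, crux `StiffCollisionalRelaxation.AprioriBounds`, stmt-AtomisticToContinuum-14827)

Helper file (`--supports stmt-AtomisticToContinuum-14827`), stub `partTwo_of_kineticRangeControl`.

Component (ii) of the crux asks, under the prefix "profiles → `∃ σ₀ ∃ η₁ ∀ σ < σ₀` → classical
hs-Euler solution on `[0, T)` → flow family with the `t = 0` LLN → `0 < t < T` with the chamber
`2ρσ³ < η₁` on `[0, t]`", that for every admissible kernel family at mesoscale `(N+1)^{-γ}`,
`γ ≤ 1/15`, there is `c₁ > 0` with `P_N{∃ s ≤ t, ∃ x, ρ̄ < c₁ ∨ 1 < ρ̄σ³} → 0`, where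
`ρ̄ = empiricalDensityField ((Φ N).flow s z) (fun y => φ N (y - x))`.

This file shows that (ii) follows from the crux `KineticRangeControl` of route `GermanoSplitLES`
(stmt-AtomisticToContinuum-9201): for every band `η₀ > 0` and profiles `∃ σ₀ ∀ σ < σ₀`, for every
classical solution with `ρσ³ < η₀` on its whole life `[0, T)`, every flow family with the `t = 0`
LLN, every CONTINUOUS kernel family `φ_N ≥ 0`, `∫φ_N = 1`, supported in `{dist(·,0) ≤ ℓ_N}` with
`φ_N ℓ_N³ ≤ A`, `Lip(φ_N) ℓ_N⁴ ≤ A`, `ℓ_N → 0`, `(N+1)ℓ_N³ / log(N+2) → ∞`, and every `t < T`: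
`∃ c, C_ρ, C` with `0 < c`, `C_ρ σ³ < η₀` such that w.h.p. the `φ_N(x − ·)`-mollified empirical
fields along the flow stay in the box `{c ≤ ρ̄ ≤ C_ρ, ‖m̄‖ ≤ C, Ē ≤ C, θ̄ ≥ c}` for ALL `s ≤ t`,
`x ∈ 𝕋³`.

The glue (`partTwo_of_kineticRangeControl`):
* level: take `η₀ := 1` in the item and `η₁ := 2` in the crux, so the crux's chamber `2ρσ³ < 2`
  on `[0, t]` is `ρσ³ < 1` there;
* life-long chamber: the chamber on `[0, t]` extends to `ρσ³ < 1` on `[0, T')` for some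
  `T' ∈ (t, T]` (`AdiabatCeiling.exists_chamber_extension`, joint continuity + compactness), and the
  solution restricts to `[0, T')` (`IsHardSphereEulerSolution.restrict`); the `t = 0` LLN is unchanged;
* kernels: the item mollifies with `φ_N(x − y)`, the crux with `φ_N(y − x)`, so the item is fed the
  REFLECTED family `y ↦ φ_N(−y)`, admissible at `ℓ_N := (N+1)^{-γ}` with `A := 2C` (continuity from
  smoothness, unit mass by negation invariance of the Haar measure of `𝕋³`, support by
  `dist(−y, 0) = dist(y, 0)`, height `φ_N ℓ_N³ ≤ C`, Lipschitz bound from `‖∇φ_N‖ ≤ C(N+1)^{4γ}`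
  by the torus mean value inequality `abs_sub_le_of_norm_gradient_le` and `‖x − y‖ ≤ dist`);
  `ℓ_N → 0` and `(N+1)ℓ_N³/log(N+2) = (N+1)^{1−3γ}/log(N+2) → ∞` since `3γ ≤ 1/5`;
* events: with `c₁ := c`, the bad event `{ρ̄ < c ∨ 1 < ρ̄σ³}` lies in the complement of the box
  event (`ρ̄ < c ⇒ ¬ c ≤ ρ̄`; `1 < ρ̄σ³`, `C_ρσ³ < 1` ⇒ `¬ ρ̄ ≤ C_ρ`), `measure_mono` + squeeze.

Adapted from `Theorems/CollisionIsometryCLTCollisionalTransferLocalityDiluteBlocksOfKineticRangeControl.lean`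
(the same glue for the dilute ceiling alone). No new definitions, no named facts; axioms `propext`,
`Classical.choice`, `Quot.sound`.
-/

noncomputable section

open MeasureTheory Filter Set Topology
open scoped ENNReal

namespace Summit.AtomisticToContinuum.HydrodynamicLimit.Theorems.AdiabatCeiling

open Literature.MathematicalPhysics.KineticTheory Literature.Analysis.FluidPDE

/-! ## Elementary facts about the mesoscale `ℓ_N = (N+1)^{-γ}` -/

-- adapted from Theorems/CollisionIsometryCLTCollisionalTransferLocalityDiluteBlocksOfKineticRangeControl.lean
/-- `x^{3γ} · (x^{-γ})³ = 1` for `x > 0`. [folklore] -/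
private theorem partTwoKRC_rpow_three_mul_mul_cube {x : ℝ} (hx : 0 < x) (γ : ℝ) :
    x ^ (3 * γ) * (x ^ (-γ)) ^ 3 = 1 := by
  have h3 : (x ^ (-γ)) ^ 3 = x ^ (-γ * 3) := by rw [Real.rpow_mul hx.le, Real.rpow_ofNat]
  rw [h3, ← Real.rpow_add hx, show 3 * γ + -γ * 3 = 0 by ring, Real.rpow_zero]

-- adapted from Theorems/CollisionIsometryCLTCollisionalTransferLocalityDiluteBlocksOfKineticRangeControl.lean
/-- `x^{4γ} · (x^{-γ})⁴ = 1` for `x > 0`. [folklore] -/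
private theorem partTwoKRC_rpow_four_mul_mul_fourth {x : ℝ} (hx : 0 < x) (γ : ℝ) :
    x ^ (4 * γ) * (x ^ (-γ)) ^ 4 = 1 := by
  have h4 : (x ^ (-γ)) ^ 4 = x ^ (-γ * 4) := by rw [Real.rpow_mul hx.le, Real.rpow_ofNat]
  rw [h4, ← Real.rpow_add hx, show 4 * γ + -γ * 4 = 0 by ring, Real.rpow_zero]

-- adapted from Theorems/CollisionIsometryCLTCollisionalTransferLocalityDiluteBlocksOfKineticRangeControl.lean
/-- `ℓ_N = (N+1)^{-γ} → 0` for `γ > 0`. [folklore] -/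
private theorem partTwoKRC_tendsto_scale {γ : ℝ} (hγ : 0 < γ) :
    Tendsto (fun N : ℕ => ((N : ℝ) + 1) ^ (-γ)) atTop (𝓝 0) :=
  (tendsto_rpow_neg_atTop hγ).comp (tendsto_natCast_atTop_atTop.atTop_add tendsto_const_nhds)

-- adapted from Theorems/CollisionIsometryCLTCollisionalTransferLocalityDiluteBlocksOfKineticRangeControl.lean
/-- The admissibility rate of the item: `(N+1) ℓ_N³ / log(N+2) = (N+1)^{1-3γ} / log(N+2) → ∞` for
`0 < γ ≤ 1/15` (lower bound `(ε/2)(N+1)^{a-ε}`, `a = 1 − 3γ`, `ε = a/2`, from `log y ≤ y^ε/ε`).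
[folklore] -/
private theorem partTwoKRC_tendsto_rate {γ : ℝ} (hγ : 0 < γ) (hγ' : γ ≤ 1 / 15) :
    Tendsto (fun N : ℕ => ((N : ℝ) + 1) * (((N : ℝ) + 1) ^ (-γ)) ^ 3 / Real.log ((N : ℝ) + 2))
      atTop atTop := by
  set a : ℝ := 1 - 3 * γ with ha
  have ha0 : 0 < a := by rw [ha]; linarith
  set ε : ℝ := a / 2 with hε
  have hε0 : 0 < ε := by positivity
  have hε1 : ε ≤ 1 := by rw [hε, ha]; linarith
  have hae : 0 < a - ε := by rw [hε]; linarith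
  have hlow : ∀ N : ℕ, ε / 2 * ((N : ℝ) + 1) ^ (a - ε) ≤
      ((N : ℝ) + 1) * (((N : ℝ) + 1) ^ (-γ)) ^ 3 / Real.log ((N : ℝ) + 2) := by
    intro N
    have hx : 0 < (N : ℝ) + 1 := by positivity
    have hx2 : 0 < (N : ℝ) + 2 := by positivity
    have hnum : ((N : ℝ) + 1) * (((N : ℝ) + 1) ^ (-γ)) ^ 3 = ((N : ℝ) + 1) ^ a := by
      have h3 : (((N : ℝ) + 1) ^ (-γ)) ^ 3 = ((N : ℝ) + 1) ^ (-γ * 3) := by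
        rw [Real.rpow_mul hx.le, Real.rpow_ofNat]
      rw [h3, show a = 1 + -γ * 3 by rw [ha]; ring, Real.rpow_add hx, Real.rpow_one]
    have hlog_pos : 0 < Real.log ((N : ℝ) + 2) := Real.log_pos (by linarith)
    have hlog : Real.log ((N : ℝ) + 2) ≤ 2 * ((N : ℝ) + 1) ^ ε / ε := by
      have h1 : Real.log ((N : ℝ) + 2) ≤ ((N : ℝ) + 2) ^ ε / ε := Real.log_le_rpow_div hx2.le hε0
      have h2 : ((N : ℝ) + 2) ^ ε ≤ 2 * ((N : ℝ) + 1) ^ ε := by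
        calc ((N : ℝ) + 2) ^ ε ≤ (2 * ((N : ℝ) + 1)) ^ ε :=
              Real.rpow_le_rpow hx2.le (by linarith) hε0.le
          _ = 2 ^ ε * ((N : ℝ) + 1) ^ ε := Real.mul_rpow (by norm_num) hx.le
          _ ≤ (2 : ℝ) ^ (1 : ℝ) * ((N : ℝ) + 1) ^ ε := by
              gcongr
              · norm_num
          _ = 2 * ((N : ℝ) + 1) ^ ε := by rw [Real.rpow_one]
      exact h1.trans (by gcongr)
    rw [hnum, le_div_iff₀ hlog_pos]
    calc ε / 2 * ((N : ℝ) + 1) ^ (a - ε) * Real.log ((N : ℝ) + 2)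
        ≤ ε / 2 * ((N : ℝ) + 1) ^ (a - ε) * (2 * ((N : ℝ) + 1) ^ ε / ε) := by gcongr
      _ = ((N : ℝ) + 1) ^ (a - ε) * ((N : ℝ) + 1) ^ ε := by field_simp
      _ = ((N : ℝ) + 1) ^ a := by rw [← Real.rpow_add hx, sub_add_cancel]
  refine tendsto_atTop_mono hlow ?_
  exact Tendsto.const_mul_atTop (by positivity)
    ((tendsto_rpow_atTop hae).comp (tendsto_natCast_atTop_atTop.atTop_add tendsto_const_nhds))

/-! ## The reflected kernel family `y ↦ φ_N(−y)` is admissible for the item -/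

-- adapted from Theorems/CollisionIsometryCLTCollisionalTransferLocalityDiluteBlocksOfKineticRangeControl.lean
/-- `dist(−x, 0) = dist(x, 0)` for the minimal-image distance on `𝕋³`. [folklore] -/
private theorem partTwoKRC_euclidDist_neg_zero (x : T3) :
    Torus.euclidDist (-x) 0 = Torus.euclidDist x 0 := by
  rw [Torus.euclidDist_comm x 0, Torus.euclidDist_eq, Torus.euclidDist_eq, sub_zero, zero_sub]

-- adapted from Theorems/CollisionIsometryCLTCollisionalTransferLocalityDiluteBlocksOfKineticRangeControl.lean
/-- The item's kernel hypotheses for the reflected family `y ↦ φ_N(−y)` of an admissible kernel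
family at `ℓ_N := (N+1)^{-γ}`: continuity, sign, unit mass, support, and the height/Lipschitz
constant `A := 2C`. [folklore] -/
private theorem partTwoKRC_reflected_admissible {γ C : ℝ} {φ : ℕ → T3 → ℝ}
    (hφ : (∀ N, Literature.Analysis.FunctionSpaces.Torus.IsSmooth (φ N)) ∧ (∀ N y, 0 ≤ φ N y) ∧
      (∀ N, ∫ y, φ N y = 1) ∧
      (∀ (N : ℕ) y, ((N : ℝ) + 1) ^ (-γ) ≤ Torus.euclidDist y 0 → φ N y = 0) ∧
      (∀ (N : ℕ) y, φ N y ≤ C * ((N : ℝ) + 1) ^ (3 * γ)) ∧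
      (∀ (N : ℕ) y, ‖Literature.Analysis.FunctionSpaces.Torus.gradient (φ N) y‖ ≤
        C * ((N : ℝ) + 1) ^ (4 * γ))) :
    (∀ N : ℕ, Continuous (fun y : T3 => φ N (-y))) ∧ (∀ (N : ℕ) (x : T3), 0 ≤ φ N (-x)) ∧
    (∀ N : ℕ, ∫ x : T3, φ N (-x) = 1) ∧
    (∀ (N : ℕ) (x : T3), ((N : ℝ) + 1) ^ (-γ) < Torus.euclidDist x 0 → φ N (-x) = 0) ∧
    (∃ A : ℝ, ∀ (N : ℕ) (x y : T3), φ N (-x) * (((N : ℝ) + 1) ^ (-γ)) ^ 3 ≤ A ∧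
      |φ N (-x) - φ N (-y)| * (((N : ℝ) + 1) ^ (-γ)) ^ 4 ≤ A * Torus.euclidDist x y) := by
  obtain ⟨hsm, hnn, hmass, hsupp, hsup, hgrad⟩ := hφ
  -- negation invariance of the Haar probability measure of `𝕋³` (product of circles)
  haveI : (volume : Measure T3).IsNegInvariant := Pi.isNegInvariant_volume
  refine ⟨fun N => (hsm N).continuous.comp continuous_neg, fun N x => hnn N (-x),
    fun N => (integral_neg_eq_self (φ N) volume).trans (hmass N),
    fun N x hx => hsupp N (-x) (by rw [partTwoKRC_euclidDist_neg_zero]; exact hx.le),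
    ⟨2 * C, fun N x y => ?_⟩⟩
  have hx : 0 < (N : ℝ) + 1 := by positivity
  -- `C ≥ 0` (a nonnegative kernel is below `C (N+1)^{3γ}`)
  have hC : 0 ≤ C := by
    have h := (hnn N x).trans (hsup N x)
    exact nonneg_of_mul_nonneg_left h (Real.rpow_pos_of_pos hx _)
  constructor
  · -- height: `φ ℓ³ ≤ C (N+1)^{3γ} ℓ³ = C ≤ 2C`
    calc φ N (-x) * (((N : ℝ) + 1) ^ (-γ)) ^ 3
        ≤ C * ((N : ℝ) + 1) ^ (3 * γ) * (((N : ℝ) + 1) ^ (-γ)) ^ 3 := by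
          gcongr
          exact hsup N (-x)
      _ = C := by rw [mul_assoc, partTwoKRC_rpow_three_mul_mul_cube hx, mul_one]
      _ ≤ 2 * C := by linarith
  · -- Lipschitz: mean value inequality on `𝕋³` with `‖∇φ_N‖ ≤ C (N+1)^{4γ}`, `√3 ≤ 2`, `‖x - y‖ ≤ dist`
    have hmv := Literature.Analysis.FluidPDE.Torus.abs_sub_le_of_norm_gradient_le (hsm N)
      (fun z => hgrad N z) (-x) (-y)
    have hsqrt : Real.sqrt (Fintype.card (Fin 3) : ℕ) ≤ 2 := by
      rw [Fintype.card_fin, Real.sqrt_le_left (by norm_num)]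
      norm_num
    have hL : 0 ≤ C * ((N : ℝ) + 1) ^ (4 * γ) := mul_nonneg hC (Real.rpow_pos_of_pos hx _).le
    have hdist : ‖-x - -y‖ ≤ Torus.euclidDist x y := by
      rw [neg_sub_neg, norm_sub_rev]
      exact Literature.Analysis.FluidPDE.Torus.norm_sub_le_euclidDist_holds x y
    have hd0 : 0 ≤ Torus.euclidDist x y := by rw [Torus.euclidDist_eq]; exact norm_nonneg _
    calc |φ N (-x) - φ N (-y)| * (((N : ℝ) + 1) ^ (-γ)) ^ 4
        ≤ Real.sqrt (Fintype.card (Fin 3) : ℕ) * (C * ((N : ℝ) + 1) ^ (4 * γ)) * ‖-x - -y‖ *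
            (((N : ℝ) + 1) ^ (-γ)) ^ 4 := by gcongr
      _ ≤ 2 * (C * ((N : ℝ) + 1) ^ (4 * γ)) * Torus.euclidDist x y *
            (((N : ℝ) + 1) ^ (-γ)) ^ 4 := by gcongr
      _ = 2 * C * Torus.euclidDist x y *
            (((N : ℝ) + 1) ^ (4 * γ) * (((N : ℝ) + 1) ^ (-γ)) ^ 4) := by ring
      _ = 2 * C * Torus.euclidDist x y := by rw [partTwoKRC_rpow_four_mul_mul_fourth hx, mul_one]

/-! ## Component (ii) from stmt-9201 -/

/-- **Component (ii) of `AprioriBounds` from stmt-9201.** The crux `GermanoSplitLES.KineticRangeControl`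
(no mesoscopic vacuum / dense pockets at any admissible kinetic filter before the shock, in local-Gibbs
probability, for classical solutions in a packing band `ρσ³ < η₀`) implies component (ii) of the crux
`StiffCollisionalRelaxation.AprioriBounds` with `η₁ := 2` and the item's `σ₀` at `η₀ := 1`: given the
data, turn the chamber `2ρσ³ < 2` on `[0, t]` into `ρσ³ < 1` on a life `[0, T')`, `t < T' ≤ T`
(`exists_chamber_extension`), restrict the solution to `[0, T')`, feed the item the reflected kernel
family `y ↦ φ_N(−y)` at `ℓ_N = (N+1)^{-γ}` (`partTwoKRC_reflected_admissible`,
`partTwoKRC_tendsto_scale`, `partTwoKRC_tendsto_rate`), note `φ_N(−(x − y)) = φ_N(y − x)`, and read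
the bad event `{∃ s ≤ t, ∃ x, ρ̄ < c ∨ 1 < ρ̄σ³}` (with `c₁ := c`) inside the complement of the
item's box event through `c ≤ ρ̄`, `ρ̄ ≤ C_ρ`, `C_ρ σ³ < 1`. -/
theorem partTwo_of_kineticRangeControl : Summit.AtomisticToContinuum.HydrodynamicLimit.Theses.GermanoSplitLES.KineticRangeControl → ∀ (a₀ θ₀ : T3 → ℝ) (u₀ : T3 → V3), Continuous a₀ → Continuous θ₀ → Continuous u₀ → (∀ x, 0 < a₀ x) → (∀ x, 0 < θ₀ x) → ∃ σ₀ : ℝ, 0 < σ₀ ∧ ∃ η₁ : ℝ, 0 < η₁ ∧ ∀ σ : ℝ, 0 < σ → σ < σ₀ → ∀ (T : ℝ) (ρ θ : ℝ → T3 → ℝ) (u : ℝ → T3 → V3), IsHardSphereEulerSolution σ T ρ u θ → ∀ Φ : (N : ℕ) → HardSphereFlow (Torus.geometry (Fin 3)) (hsDiameter σ N) (N + 1), TendstoHydroFieldsAt (fun N => localGibbsLaw σ a₀ u₀ θ₀ N (Φ N)) Φ ρ u θ 0 → ∀ t : ℝ, 0 < t → t < T → (∀ s ∈ Icc 0 t,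 ∀ x, 2 * ρ s x * σ ^ 3 < η₁) → ∀ (γ C : ℝ) (φ : ℕ → T3 → ℝ), 0 < γ → γ ≤ 1 / 15 → ((∀ N, Literature.Analysis.FunctionSpaces.Torus.IsSmooth (φ N)) ∧ (∀ N y, 0 ≤ φ N y) ∧ (∀ N, ∫ y, φ N y = 1) ∧ (∀ (N : ℕ) y, ((N : ℝ) + 1) ^ (-γ) ≤ Torus.euclidDist y 0 → φ N y = 0) ∧ (∀ (N : ℕ) y, φ N y ≤ C * ((N : ℝ) + 1) ^ (3 * γ)) ∧ (∀ (N : ℕ) y, ‖Literature.Analysis.FunctionSpaces.Torus.gradient (φ N) y‖ ≤ C * ((N : ℝ) + 1) ^ (4 * γ))) → ∃ c₁ : ℝ, 0 < c₁ ∧ Tendsto (fun N : ℕ => localGibbsLaw σ a₀ u₀ θ₀ N (Φ N) {z | ∃ s ∈ Icc 0 t, ∃ x : T3, empiricalDensityField ((Φ N).flow s z) (fun y => φ N (y - x)) < c₁ ∨ 1 < empiricalDensityField ((Φ N).flow s z) (fun y => φ N (y - x)) * σ ^ 3}) atTop (𝓝 0) := by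
  intro hK a₀ θ₀ u₀ ha hθ hu ha0 hθ0
  -- the item at level `η₀ := 1`
  obtain ⟨σ₀, hσ₀, H⟩ := hK 1 one_pos a₀ θ₀ u₀ ha hθ hu ha0 hθ0
  refine ⟨σ₀, hσ₀, 2, two_pos, fun σ hσ hσlt T ρ θ u hE Φ hL t ht htT hch γ C φ hγ hγ' hφ => ?_⟩
  -- the chamber `2ρσ³ < 2` on `[0, t]` is `ρσ³ < 1` there; extend it to a life `[0, T')` and restrict
  have hch1 : ∀ s ∈ Icc 0 t, ∀ x, ρ s x * σ ^ 3 < 1 := fun s hs x => by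
    have h := hch s hs x
    linarith
  obtain ⟨T', htT', hT'T, hch'⟩ := exists_chamber_extension hE hσ ht.le htT hch1
  have hE' := hE.restrict hT'T
  -- the reflected kernel family at `ℓ_N = (N+1)^{-γ}`
  obtain ⟨h1, h2, h3, h4, h5⟩ := partTwoKRC_reflected_admissible hφ
  have h6 : ∀ N : ℕ, 0 < ((N : ℝ) + 1) ^ (-γ) := fun N => Real.rpow_pos_of_pos (by positivity) _
  obtain ⟨c, Cρ, C', hc, hCρ, -, hT⟩ := H σ hσ hσlt T' ρ θ u hE' hch' Φ hL (fun N y => φ N (-y))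
    (fun N => ((N : ℝ) + 1) ^ (-γ)) h1 h2 h3 h4 h5 h6 (partTwoKRC_tendsto_scale hγ)
    (partTwoKRC_tendsto_rate hγ hγ') t ⟨ht.le, htT'⟩
  -- `c₁ := c`; the bad event sits inside the complement of the box event
  refine ⟨c, hc, tendsto_of_tendsto_of_tendsto_of_le_of_le tendsto_const_nhds hT (fun N => bot_le)
    (fun N => measure_mono ?_)⟩
  rintro z ⟨s, hs, x, hx⟩
  simp only [Set.mem_setOf_eq]
  refine ⟨s, hs, x, fun hbox => ?_⟩
  have hge : c ≤ empiricalDensityField ((Φ N).flow s z) (fun y => φ N (-(x - y))) := hbox.1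
  have hle : empiricalDensityField ((Φ N).flow s z) (fun y => φ N (-(x - y))) ≤ Cρ := hbox.2.1
  have hrho : empiricalDensityField ((Φ N).flow s z) (fun y => φ N (y - x)) =
      empiricalDensityField ((Φ N).flow s z) (fun y => φ N (-(x - y))) := by
    simp only [neg_sub]
  have hσ3 : 0 < σ ^ 3 := pow_pos hσ 3
  rw [hrho] at hx
  rcases hx with hx | hx
  · exact absurd hge (not_le.2 hx)
  · nlinarith
end Summit.AtomisticToContinuum.HydrodynamicLimit.Theorems.AdiabatCeiling

end
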